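import Summits.QuantumFields.BalabanUV.Beta.D1BFx.RColumnProfile

/-!
# `BalabanUV.Beta.D1BFx.RColumnProfileDipole` — road «BF-x» for binder row D1, slot (K), END row `hGrp gN`, «GN-L3» PART 2e (owner ruling ρ-g9-33 (L2)∕(L4);
# an3-g57 §3′ (2)∕(4)): THE POINTWISE PROFILE OF THE K-DIPOLE COLUMN `δρ_s := RG(·, s+e_ρ) − RG(·, s)` (difference in the SOURCE slot),
# `|RG(x,s+e_ρ) − RG(x,s)| ≤ kD(a)∕n² · e^{−(dR(a)∕2∕n)‖x−s‖∞} ∕ nrm(x−s)³` — EVERY `x`, in the `LatticeHLSProfiles` currency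

HONEST DEPENDENCY (cell records, verbatim): «continuum YM on T⁴ ⇐ BetaPertH ∧ nine spine estimates (0/9 proved); BetaPertH ⇐ (D1) ∧ (D4) ∧
CAP+tail; G-an2-4 gates asym, D1 and NE2/3/4.»  HONEST FRAMING (cell contract, verbatim): «discharging `BetaPertH` makes Bałaban's UV stability
UNCONDITIONAL — a real constructive-QFT result; it is NOT the continuum limit and NOT the Clay problem.»  THIS MODULE DISCHARGES NOTHING of the wall:
[folklore] pointwise assembly BY NAME — `GhostLegBlockMassD1.abs_Ggh_diff_le_of_ne`∕`abs_Ggh_le_sharp` (`ghost_d1`∕`ghost_h0`) read through `Ggh_symm`,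
`ProjectorSupNorm.abs_Pgt_le_sup` ⊛ the M10-d1 block column `GhostLegBlockMassD1.sum_B_abs_Ggh_diff_col_le` (`RColumnBlockMass.sum_abs_tsum_le_conv`), and PART 2d's
geometry∕absorption (`RColumnProfile.offDiag`∕`absorb`); no `def … : Prop`, no hypothesis is a printed statement, 0 binders of row D1 touched; (K) NOT closed;
NOT (CONV-C), NOT D1, NOT BetaPertH, NOT continuum, NOT Clay.

WHY (an3-g57 §3′ (2) «`δρ_u := RG(·,u′) − RG(·,u)` … `S_{δρ} = k n⁻²` (no UV gain, M8)», (4) R2⊗R2∕R1⊗R2 UV corners «`(Ga∇δρ_u)(ξ) ≤ k n⁻²·nrm(ξ−u)⁻²`» =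
`LatticeHLSProfiles` placement (3,3) with `|δρ_u(x)| ≤ A∕nrm(x−u)³`; PART 2b has the MASS `sum_B_abs_RG_col_diff_le`, PART 2d the x-gradient profile; this is
the source-slot twin).  CONTENT ([folklore]; constants **`cSm1 a := cPPs(4,a)·cNear1 a·K₄(ghDelta a∕2)`**, **`kD a := ghA1 a + 2(cG0 4 + cSplit 4 a) + cSm1 a·cAbs 3 a`**):
**`abs_comp_right_diff_le`** (`|Σ'_z Pgt x z·(Ggh z (s+e_ρ) − Ggh z s)| ≤ cSm1∕n⁵·e^{−dR·dist(blk x, blk s)}`), **`abs_RG_right_diff_le_profile`** (damped, every x),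
**`abs_RG_right_diff_le_inv_cube`** (`kD∕n² ∕ nrm(x−s)³`).  NOT HERE: mixed second differences (never needed, an3 §3′ (2)); any END row.
Unit `b2b-balaban-gan24-formalise-leaf-05` (gen 41), G-an2-4 swarm leaf prover on cross-lane kernel duty; `LEAVES-BFx.md` row (N) «GN-L3» PART 2e.
-/

namespace Summit.QuantumFields.BalabanUV.Beta.D1BFx.RColumnProfileDipole

open Finset
open scoped BigOperators
open Literature.MathematicalPhysics.QuantumFieldTheory.Balaban1983to89
open Literature.MathematicalPhysics.QuantumFieldTheory.Balaban1983to89.Beta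
open B4Sect5Proof (latticeConst latticeConst_nonneg)
open B6QGQLower276 (X blk B mem_B)
open Beta.PoissonInterior (nrm nrm_pos supNorm_eq_zero_iff)
open DyadicShell (Pt supNorm)
open AffineAveraging (unitVec)
open Summit.QuantumFields.BalabanUV.Beta.D1BFx.RProjector (Pgt deltaPP deltaPP_pos)
open Summit.QuantumFields.BalabanUV.Beta.D1BFx.ProjectorSupNorm (cPPs cPPs_nonneg abs_Pgt_le_sup)
open Summit.QuantumFields.BalabanUV.Beta.D1BFx.GhostLeg (Ggh Ggh_symm)
open Summit.QuantumFields.BalabanUV.Beta.D1BFx.RProjectorJet (RG)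
open Summit.QuantumFields.BalabanUV.Beta.D1BFx.RdotBlockRange (summable_Pgt_mul_Ggh)
open Summit.QuantumFields.BalabanUV.Beta.D1BFx.GhostLegFree (ghA1 ghDelta ghDelta_pos supNorm_eq)
open Summit.QuantumFields.BalabanUV.Beta.D1BFx.PointColumnSplit (cG0 cG0_nonneg cSplit cSplit_nonneg)
open Summit.QuantumFields.BalabanUV.Beta.D1BFx.GhostLegBlockMassD1 (cNear1 ghA1_nonneg abs_Ggh_le_sharp abs_Ggh_diff_le_of_ne sum_B_abs_Ggh_diff_col_le)
open Summit.QuantumFields.BalabanUV.Beta.D1BFx.GhostLegBlockMassD1Summed (supNorm_sub_comm)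
open Summit.QuantumFields.BalabanUV.Beta.D1BFx.RColumnBlockMass (dR dR_pos cNear1_nonneg RG_apply sum_abs_tsum_le_conv)
open Summit.QuantumFields.BalabanUV.Beta.D1BFx.RColumnProfile (cAbs one_le_cAbs absorb offDiag exp_ghDelta_le_exp_half_dR)

noncomputable section

/-- [our constant] The smooth-part constant of the dipole column `cPPs·cNear1·K₄(ghDelta∕2)`. -/
def cSm1 (a : ℝ) : ℝ := cPPs 4 a * cNear1 a * latticeConst 4 (ghDelta a / 2)

/-- [our constant] The profile constant of the dipole column. -/
def kD (a : ℝ) : ℝ := ghA1 a + 2 * (cG0 4 + cSplit 4 a) + cSm1 a * cAbs 3 a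

variable {a : ℝ}

/-- [folklore] `0 ≤ cSm1 a`. -/
theorem cSm1_nonneg (ha : 0 < a) : 0 ≤ cSm1 a :=
  mul_nonneg (mul_nonneg (cPPs_nonneg 4 ha) (cNear1_nonneg ha)) (latticeConst_nonneg 4 (half_pos (ghDelta_pos ha)).le)

/-- [folklore] `0 ≤ kD a`. -/
theorem kD_nonneg (ha : 0 < a) : 0 ≤ kD a := by
  unfold kD; have := ghA1_nonneg ha; have := cG0_nonneg 4; have := cSplit_nonneg 4 ha; have := cSm1_nonneg ha
  have := one_le_cAbs ha 3; positivity

variable (n : ℕ) [NeZero n]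

/-- [folklore] **THE SMOOTH PART OF THE DIPOLE COLUMN**: `|Σ'_z Pgt(x,z)·(Ggh(z,s+e_ρ) − Ggh(z,s))| ≤ cSm1 a∕n⁵ · e^{−dR a·dist(blk x, blk s)}`
(M4 sup ⊛ M10-d1 block column). -/
theorem abs_comp_right_diff_le (ha : 0 < a) (x s : X 4) (ρ : Fin 4) :
    |∑' z : X 4, (Pgt n a x z () () * Ggh n a z (s + unitVec ρ) () () - Pgt n a x z () () * Ggh n a z s () ())|
      ≤ cSm1 a / (n : ℝ) ^ 5 * Real.exp (-(dR a * dist (blk (n - 1) x) (blk (n - 1) s))) := by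
  have hn : (0 : ℝ) < n := Nat.cast_pos.mpr (Nat.pos_of_ne_zero (NeZero.ne n))
  set u : X 4 := unitVec ρ with hu
  have hcol : ∀ w, ∑ z ∈ B (n - 1) w, |Ggh n a z (s + u) () () - Ggh n a z s () ()|
      ≤ cNear1 a / n * Real.exp (-(ghDelta a * dist w (blk (n - 1) s))) := by
    intro w
    have h := sum_B_abs_Ggh_diff_col_le n ha s w ρ
    rwa [dist_comm] at h
  have h := sum_abs_tsum_le_conv n ({x} : Finset (X 4))
    (fun i z => Pgt n a i z () () * Ggh n a z (s + u) () () - Pgt n a i z () () * Ggh n a z s () ())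
    (fun i _ => (summable_Pgt_mul_Ggh n ha i (s + u)).sub (summable_Pgt_mul_Ggh n ha i s))
    (f := fun w => cPPs 4 a / (n : ℝ) ^ 4 * Real.exp (-(deltaPP 4 a * dist (blk (n - 1) x) w)))
    (g := fun w => ∑ z ∈ B (n - 1) w, |Ggh n a z (s + u) () () - Ggh n a z s () ()|)
    (deltaPP_pos 4 ha) (ghDelta_pos ha) (div_nonneg (cPPs_nonneg 4 ha) (pow_pos hn 4).le) (div_nonneg (cNear1_nonneg ha) hn.le)
    (blk (n - 1) x) (blk (n - 1) s)
    (fun w => ?_) (fun w => mul_nonneg (div_nonneg (cPPs_nonneg 4 ha) (pow_pos hn 4).le) (Real.exp_pos _).le)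
    (fun w => Finset.sum_nonneg fun z _ => abs_nonneg _) (fun w => le_rfl) hcol
  · rw [Finset.sum_singleton] at h
    refine h.trans (le_of_eq ?_)
    unfold cSm1 dR; field_simp
  · show ∑ z ∈ B (n - 1) w, ∑ i ∈ ({x} : Finset (X 4)), |Pgt n a i z () () * Ggh n a z (s + u) () () - Pgt n a i z () () * Ggh n a z s () ()|
      ≤ (cPPs 4 a / (n : ℝ) ^ 4 * Real.exp (-(deltaPP 4 a * dist (blk (n - 1) x) w))) * ∑ z ∈ B (n - 1) w, |Ggh n a z (s + u) () () - Ggh n a z s () ()|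
    rw [Finset.mul_sum]
    refine Finset.sum_le_sum fun z hz => ?_
    rw [Finset.sum_singleton, ← mul_sub, abs_mul]
    refine mul_le_mul_of_nonneg_right ?_ (abs_nonneg _)
    have hP := abs_Pgt_le_sup n ha x z () ()
    rwa [mem_B.1 hz] at hP

/-- [folklore] **THE PROFILE OF THE K-DIPOLE COLUMN** (every `x`, diagonal included):
`|RG(x,s+e_ρ) − RG(x,s)| ≤ kD a∕n² · e^{−(dR a∕2∕n)·‖x−s‖∞} ∕ nrm(x−s)³`. -/
theorem abs_RG_right_diff_le_profile (ha : 0 < a) (x s : X 4) (ρ : Fin 4) :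
    |RG (Ggh n a) (Pgt n a) x (s + unitVec ρ) () () - RG (Ggh n a) (Pgt n a) x s () ()|
      ≤ kD a / (n : ℝ) ^ 2 * Real.exp (-(dR a / 2 / n) * Beta.PoissonInterior.supNorm (x - s)) / nrm (x - s) ^ 3 := by
  have hn : (0 : ℝ) < n := Nat.cast_pos.mpr (Nat.pos_of_ne_zero (NeZero.ne n))
  have hn1 : (1 : ℝ) ≤ n := by exact_mod_cast NeZero.one_le
  have hC0 : 0 ≤ cG0 4 + cSplit 4 a := add_nonneg (cG0_nonneg 4) (cSplit_nonneg 4 ha)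
  have hA1 : 0 ≤ ghA1 a := ghA1_nonneg ha
  have hSm := cSm1_nonneg ha
  have hAb := one_le_cAbs ha 3
  set u : X 4 := unitVec ρ with hu
  have e1 : RG (Ggh n a) (Pgt n a) x (s + u) () () - RG (Ggh n a) (Pgt n a) x s () ()
      = (Ggh n a x (s + u) () () - Ggh n a x s () ())
        - ∑' z : X 4, (Pgt n a x z () () * Ggh n a z (s + u) () () - Pgt n a x z () () * Ggh n a z s () ()) := by
    rw [RG_apply, RG_apply, (summable_Pgt_mul_Ggh n ha x (s + u)).tsum_sub (summable_Pgt_mul_Ggh n ha x s)]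
    ring
  rw [← supNorm_eq, e1]
  have hcomp := abs_comp_right_diff_le n ha x s ρ
  have hE1 : Real.exp (-(dR a * dist (blk (n - 1) x) (blk (n - 1) s))) ≤ 1 := by
    rw [Real.exp_le_one_iff, neg_nonpos]; exact mul_nonneg (dR_pos ha).le dist_nonneg
  refine (abs_sub _ _).trans ?_
  by_cases hxs : x = s
  · subst hxs
    have h0 : (supNorm (x - x) : ℝ) = 0 := by
      rw [sub_self, supNorm_eq]; exact_mod_cast (supNorm_eq_zero_iff (d := 4)).2 rfl
    have hnrm : nrm (x - x) = 1 := by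
      show max 1 ((Beta.PoissonInterior.supNorm (x - x) : ℕ) : ℝ) = 1
      rw [← supNorm_eq, h0]; simp
    rw [h0, hnrm, mul_zero, Real.exp_zero, mul_one, one_pow, div_one]
    have h1 : |Ggh n a x (x + u) () () - Ggh n a x x () ()| ≤ 2 * (cG0 4 + cSplit 4 a) / (n : ℝ) ^ 2 := by
      have ha1 := abs_Ggh_le_sharp n ha x (x + u)
      have ha2 := abs_Ggh_le_sharp n ha x x
      calc _ ≤ |Ggh n a x (x + u) () ()| + |Ggh n a x x () ()| := abs_sub _ _
        _ ≤ 2 * (cG0 4 + cSplit 4 a) / (n : ℝ) ^ 2 := by rw [mul_div_assoc]; linarith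
    have h2 : |∑' z : X 4, (Pgt n a x z () () * Ggh n a z (x + u) () () - Pgt n a x z () () * Ggh n a z x () ())|
        ≤ cSm1 a * cAbs 3 a / (n : ℝ) ^ 2 := by
      refine hcomp.trans ?_
      calc cSm1 a / (n : ℝ) ^ 5 * Real.exp (-(dR a * dist (blk (n - 1) x) (blk (n - 1) x)))
          ≤ cSm1 a / (n : ℝ) ^ 5 * 1 := mul_le_mul_of_nonneg_left hE1 (by positivity)
        _ ≤ cSm1 a * cAbs 3 a / (n : ℝ) ^ 2 := by
            rw [mul_one, div_le_div_iff₀ (by positivity) (by positivity)]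
            have : (n : ℝ) ^ 2 ≤ (n : ℝ) ^ 5 := pow_le_pow_right₀ hn1 (by norm_num)
            calc cSm1 a * (n : ℝ) ^ 2 ≤ cSm1 a * (n : ℝ) ^ 5 := mul_le_mul_of_nonneg_left this hSm
              _ = cSm1 a * 1 * (n : ℝ) ^ 5 := by ring
              _ ≤ cSm1 a * cAbs 3 a * (n : ℝ) ^ 5 := mul_le_mul_of_nonneg_right (mul_le_mul_of_nonneg_left hAb hSm) (by positivity)
    calc |Ggh n a x (x + u) () () - Ggh n a x x () ()|
          + |∑' z : X 4, (Pgt n a x z () () * Ggh n a z (x + u) () () - Pgt n a x z () () * Ggh n a z x () ())|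
        ≤ 2 * (cG0 4 + cSplit 4 a) / (n : ℝ) ^ 2 + cSm1 a * cAbs 3 a / (n : ℝ) ^ 2 := add_le_add h1 h2
      _ ≤ kD a / (n : ℝ) ^ 2 := by
          rw [← add_div]; apply div_le_div_of_nonneg_right _ (pow_pos hn 2).le; unfold kD; linarith
  · obtain ⟨hN, hnrm, hND⟩ := offDiag n x s hxs
    set N : ℝ := (supNorm (x - s) : ℝ) with hNdef
    set D : ℝ := dist (blk (n - 1) x) (blk (n - 1) s) with hDdef
    rw [hnrm]
    have hG : |Ggh n a x (s + u) () () - Ggh n a x s () ()| ≤ ghA1 a * (Real.exp (-(dR a / 2 / n) * N) / ((n : ℝ) ^ 2 * N ^ 3)) := by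
      have hsx : s ≠ x := fun h => hxs h.symm
      have h := abs_Ggh_diff_le_of_ne n ha hsx ρ
      rw [supNorm_sub_comm s x, mul_div_assoc] at h
      rw [Ggh_symm n a ha x (s + u) () (), Ggh_symm n a ha x s () ()]
      exact h.trans (mul_le_mul_of_nonneg_left
        (div_le_div_of_nonneg_right (exp_ghDelta_le_exp_half_dR n ha hN.le) (by positivity)) hA1)
    have hS : |∑' z : X 4, (Pgt n a x z () () * Ggh n a z (s + u) () () - Pgt n a x z () () * Ggh n a z s () ())|
        ≤ cSm1 a * cAbs 3 a * (Real.exp (-(dR a / 2 / n) * N) / ((n : ℝ) ^ 2 * N ^ 3)) := by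
      have hab := absorb n ha (p := 3) (by norm_num) hN dist_nonneg hND
      refine hcomp.trans ?_
      calc cSm1 a / (n : ℝ) ^ 5 * Real.exp (-(dR a * D)) = cSm1 a / (n : ℝ) ^ 2 * (((n : ℝ) ^ 3)⁻¹ * Real.exp (-(dR a * D))) := by
            field_simp
        _ ≤ cSm1 a / (n : ℝ) ^ 2 * (cAbs 3 a * (Real.exp (-(dR a / 2 / n) * N) / N ^ 3)) := mul_le_mul_of_nonneg_left hab (by positivity)
        _ = cSm1 a * cAbs 3 a * (Real.exp (-(dR a / 2 / n) * N) / ((n : ℝ) ^ 2 * N ^ 3)) := by field_simp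
    calc |Ggh n a x (s + u) () () - Ggh n a x s () ()|
          + |∑' z : X 4, (Pgt n a x z () () * Ggh n a z (s + u) () () - Pgt n a x z () () * Ggh n a z s () ())|
        ≤ (ghA1 a + cSm1 a * cAbs 3 a) * (Real.exp (-(dR a / 2 / n) * N) / ((n : ℝ) ^ 2 * N ^ 3)) := by rw [add_mul]; exact add_le_add hG hS
      _ ≤ kD a * (Real.exp (-(dR a / 2 / n) * N) / ((n : ℝ) ^ 2 * N ^ 3)) :=
          mul_le_mul_of_nonneg_right (by unfold kD; linarith) (by positivity)
      _ = kD a / (n : ℝ) ^ 2 * Real.exp (-(dR a / 2 / n) * N) / N ^ 3 := by field_simp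

/-- [folklore] **UNDAMPED DIPOLE PROFILE**: `|RG(x,s+e_ρ) − RG(x,s)| ≤ (kD a∕n²) ∕ nrm(x−s)³` — the `hf` input of `LatticeHLSProfiles` at `b = 3`. -/
theorem abs_RG_right_diff_le_inv_cube (ha : 0 < a) (x s : X 4) (ρ : Fin 4) :
    |RG (Ggh n a) (Pgt n a) x (s + unitVec ρ) () () - RG (Ggh n a) (Pgt n a) x s () ()| ≤ kD a / (n : ℝ) ^ 2 / nrm (x - s) ^ 3 := by
  have hn : (0 : ℝ) < n := Nat.cast_pos.mpr (Nat.pos_of_ne_zero (NeZero.ne n))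
  refine (abs_RG_right_diff_le_profile n ha x s ρ).trans (div_le_div_of_nonneg_right ?_ (pow_pos (nrm_pos _) 3).le)
  have hkD : 0 ≤ kD a / (n : ℝ) ^ 2 := div_nonneg (kD_nonneg ha) (pow_pos hn 2).le
  have hE : Real.exp (-(dR a / 2 / n) * Beta.PoissonInterior.supNorm (x - s)) ≤ 1 := by
    rw [Real.exp_le_one_iff, neg_mul, neg_nonpos]; exact mul_nonneg (by have := dR_pos ha; positivity) (Nat.cast_nonneg _)
  exact (mul_le_mul_of_nonneg_left hE hkD).trans (le_of_eq (mul_one _))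

end

end Summit.QuantumFields.BalabanUV.Beta.D1BFx.RColumnProfileDipole
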